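import Mathlib
import HarnessLib
import Summits.HubbardSuperconductivity.HubbardSuperconductivity.Theorems.KLProgrammeKLRegimeEnginePairTransferGridRunningGram
import Summits.HubbardSuperconductivity.HubbardSuperconductivity.Theorems.KLProgrammeKLRegimeEnginePairTransferGridDLineGram

/-!
# Route `KLProgramme` — ENGINE (stmt-HubbardSuperconductivity-20437 `KLRegimeEngineV17F2`), class #5 / row (X).2′: the RUNNING member symbol's grid Gram constant WITH THE SCALE —
# **`klmg_isGramBoundedR_gridSub_runningSymbol_decay`**: `IsGramBoundedR (Sᵀ·softCovOf K_{n+1} (Φ t)·S) √(Λₙ·15367)` (cure «95v6» of located #28, lemma file)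

Cell gate-hubbard-kl, seat hubbard-kl-k3c1-p1 g28 (technique «composed-map remainder propagation»; custodian of binder #4's Pinned2SB chain 95v4/95v5).  Located #28
«(X)-M4-GRID-MAJORANT-SIX-LEG» (p1 g29, certificate p770325, OF RECORD ×3): binder #4's `M4` row is the `p = 2` GRID-BINOMIAL MAJORANT of `klmg_kernel4_le_gridBinomial` read at the
n-FLAT Gram constant `γ = √6047` of `klmg_isGramBoundedR_gridSub_runningSymbol`; its `m′ = 3` summand `15·γ²·(…)·Ng 3` then carries the near-slice six-point tree WITHOUT the loop gain
(`≍ 6047·U²·4ⁿ` under (P1)), forcing `c₄ ≥ (16/15)·U·4ⁿ` and killing the thresholds for `n ≥ 42`.  The flat `6047` is only a crude bound: by row 45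
(`klmg_isGramBoundedR_gridSub_softCovOf_of_mass_le`) the Gram constant IS the phase-space MASS of the symbol, `= Λₙ·klSoftMass K n φ` (`klmg_isGramBoundedR_gridSub_of_klSoftMass_le`,
the currency of the `κD` rows and of the member-array majorant `hexportG`, `γ² = Λₙ·15367`), and the running symbol `Φ t = s_{n+1,i} + (w_{Λₙ₊₁} − w_{Λ(t)}) = w_{Λ_i} − w_{Λ(t)}` sits
pointwise between `0` and `s_{n,i} = w_{Λ_i} − w_{Λₙ}` (`Λ_i ≤ Λₙ₊₁ ≤ Λ(t) ≤ Λₙ`, `w` antitone in the cutoff), whose soft mass at scale `n` is `≤ klIdxMass n n = 15367`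
(`klSoftMass_compl_sub_compl_le_klIdxMass`).  Hence:

* `klmg_runningSymbol_abs_le_compl` — `|Φ t k| ≤ |s_{n,i}(k) − s_{n,n}(k)|`;
* `klmg_klSoftMass_runningSymbol_le` — `klSoftMass K n (Φ t) ≤ 15367`;
* **`klmg_isGramBoundedR_gridSub_runningSymbol_decay`** — `IsGramBoundedR (Sᵀ·softCovOf K (Φ t)·S) √(Λₙ·15367)`, same binders as the flat lemma (`FrameOK`, `klBetaMin ≤ β ≤ L`,
  `n + 1 ≤ i`, `t ∈ [0,1]`, any grid).

With `γ² = Λₙ·15367` the `m′ = 3` summand of the `M4` majorant is `≍ 15·15367·Λₙ·(U²/Λₙ) ≍ 2.3·10⁵·klE0-free·U²` — n-FLAT, inside `M4 ≤ c₄·U` with `c₄` n-flat — which is located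
#28's own «contrast» remark («hexportG … γ² = Λₙ·15367 … n-flat, harmless») applied to the `M4` row.  The chain files of «95v6» (layer BudgetGrid onwards, the `M4` grid row re-weighted)
follow.  Everything is proved; no definitions; nothing about the model's sizes is asserted; nothing asserts (X).2′, (X), K3, U₀, the window or superconductivity.  0 kit · 0 lit.
-/

noncomputable section

namespace Summit.HubbardSuperconductivity.HubbardSuperconductivity.Theorems.KLRegimeSplit

set_option linter.dupNamespace false -- summit = problem name (single-conjunct summit), D-0017

open Finset Matrix Set Literature.MathematicalPhysics.QuantumLattice Literature.Probability.LatticeModels GrassmannAlgebra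
open Summit.HubbardSuperconductivity.HubbardSuperconductivity.Theorems.KLProgrammeLegKernels
open Summit.HubbardSuperconductivity.HubbardSuperconductivity.Theorems.DispersionFlow
open Summit.HubbardSuperconductivity.HubbardSuperconductivity.Theorems.KLRegimeWick
open Summit.HubbardSuperconductivity.HubbardSuperconductivity.Theorems.EngineV8

variable (L M : ℕ) [NeZero L]

omit [NeZero L] in
/-- **The running symbol sits below the scale-`n` complementary symbol**: for `n + 1 ≤ i` and `t ∈ [0,1]`,
`|s_{n+1,i}(k) + (w^K_{Λₙ₊₁}(k) − w^K_{Λ(t)}(k))| ≤ |s_{n,i}(k) − s_{n,n}(k)|` — both sides are `w^K_{Λ_i} − w^K_{Λ(t)}` resp. `w^K_{Λ_i} − w^K_{Λₙ}` and `Λ_i ≤ Λₙ₊₁ ≤ Λ(t) ≤ Λₙ`. -/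
theorem klmg_runningSymbol_abs_le_compl (β μ : ℝ) (K : TrigPolyC4v) (n i : ℕ) (hi : n + 1 ≤ i) {t : ℝ} (ht : t ∈ Icc (0 : ℝ) 1) (k : FreqMomentum L M) :
    |softSymbolCompl L M β μ K (n + 1) i k + (hubbardCutoffWeightCT L M β μ K (klScale klE0 (n + 1)) k -
        hubbardCutoffWeightCT L M β μ K (klScale klE0 n + t * (klScale klE0 (n + 1) - klScale klE0 n)) k)| ≤
      |softSymbolCompl L M β μ K n i k - softSymbolCompl L M β μ K n n k| := by
  obtain ⟨hlo, hhi⟩ := scaleAt_mem n ht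
  -- `w_{Λₙ} ≤ w_{Λ(t)} ≤ w_{Λₙ₊₁} ≤ w_{Λ_i}`
  have hwi : hubbardCutoffWeightCT L M β μ K (klScale klE0 (n + 1)) k ≤ hubbardCutoffWeightCT L M β μ K (klScale klE0 i) k :=
    hubbardCutoffWeightCT_klScale_mono (L := L) β μ K hi k
  have hwt : hubbardCutoffWeightCT L M β μ K (klScale klE0 n + t * (klScale klE0 (n + 1) - klScale klE0 n)) k ≤
      hubbardCutoffWeightCT L M β μ K (klScale klE0 (n + 1)) k :=
    klmg_hubbardCutoffWeightCT_anti L M β μ K (klth_klScale_pos (n + 1)) hlo k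
  have hwn : hubbardCutoffWeightCT L M β μ K (klScale klE0 n) k ≤
      hubbardCutoffWeightCT L M β μ K (klScale klE0 n + t * (klScale klE0 (n + 1) - klScale klE0 n)) k :=
    klmg_hubbardCutoffWeightCT_anti L M β μ K (lt_of_lt_of_le (klth_klScale_pos (n + 1)) hlo) hhi k
  unfold softSymbolCompl
  rw [sub_self, sub_zero, abs_le]
  have hR : |hubbardCutoffWeightCT L M β μ K (klScale klE0 i) k - hubbardCutoffWeightCT L M β μ K (klScale klE0 n) k| =
      hubbardCutoffWeightCT L M β μ K (klScale klE0 i) k - hubbardCutoffWeightCT L M β μ K (klScale klE0 n) k :=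
    abs_of_nonneg (by linarith)
  rw [hR]
  constructor <;> linarith

/-- **The running symbol's soft mass at scale `n` is at most `15367`** (`= klIdxMass n n`): for an admissible frame (`FrameOK R U N μ K`), `klBetaMin ≤ β ≤ L`, `n + 1 ≤ i`,
`t ∈ [0,1]`. -/
theorem klmg_klSoftMass_runningSymbol_le [NeZero M] {R : RenConsts} {U : ℝ} {Nsc : ℕ} {μ : ℝ} {K : TrigPolyC4v} (hK : FrameOK R U Nsc μ K)
    {β : ℝ} (hβ : klBetaMin ≤ β) (hβL : β ≤ L) (n i : ℕ) (hi : n + 1 ≤ i)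
    (Φ : ℝ → FreqMomentum L M → ℝ) (hΦ : Φ = fun t k => softSymbolCompl L M β μ K (n + 1) i k + (hubbardCutoffWeightCT L M β μ K (klScale klE0 (n + 1)) k -
        hubbardCutoffWeightCT L M β μ K (klScale klE0 n + t * (klScale klE0 (n + 1) - klScale klE0 n)) k))
    {t : ℝ} (ht : t ∈ Icc (0 : ℝ) 1) : klSoftMass L M β μ K n (Φ t) ≤ 15367 := by
  have hβ0 : 0 < β := pos_of_klBetaMin_le hβ
  have h1 : klSoftMass L M β μ K n (Φ t) ≤ klSoftMass L M β μ K n (softSymbolCompl L M β μ K n i - softSymbolCompl L M β μ K n n) := by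
    refine klSoftMass_mono β μ K hβ0 n fun k => ?_
    rw [hΦ]
    exact klmg_runningSymbol_abs_le_compl L M β μ K n i hi ht k
  have h2 : klSoftMass L M β μ K n (softSymbolCompl L M β μ K n i - softSymbolCompl L M β μ K n n) ≤ klIdxMass n n :=
    klSoftMass_compl_sub_compl_le_klIdxMass β μ K hK hβ hβL le_rfl (by omega)
  have h3 : klIdxMass n n = 15367 := by unfold klIdxMass; simp
  linarith

/-- **`klmg_isGramBoundedR_gridSub_runningSymbol_decay`** — the `γ` row WITH THE SCALE: for an admissible frame (`FrameOK R U N μ K`), `klBetaMin ≤ β ≤ L`, `n + 1 ≤ i`, `t ∈ [0,1]`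
and ANY grid `Ng`, with `Φ` the running-symbol pin (`Φ = fun t k => s_{n+1,i}(k) + (w^K_{Λ_{n+1}}(k) − w^K_{Λ(t)}(k))`):
`IsGramBoundedR (Sᵀ·softCovOf K (Φ t)·S) √(Λₙ·15367)`, `S = hubbardGridSub L M β Ng` — the decaying twin of `klmg_isGramBoundedR_gridSub_runningSymbol` (`√6047`). -/
theorem klmg_isGramBoundedR_gridSub_runningSymbol_decay [NeZero M] {R : RenConsts} {U : ℝ} {Nsc : ℕ} {μ : ℝ} {K : TrigPolyC4v} (hK : FrameOK R U Nsc μ K)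
    {β : ℝ} (hβ : klBetaMin ≤ β) (hβL : β ≤ L) (n i : ℕ) (hi : n + 1 ≤ i)
    (Φ : ℝ → FreqMomentum L M → ℝ) (hΦ : Φ = fun t k => softSymbolCompl L M β μ K (n + 1) i k + (hubbardCutoffWeightCT L M β μ K (klScale klE0 (n + 1)) k -
        hubbardCutoffWeightCT L M β μ K (klScale klE0 n + t * (klScale klE0 (n + 1) - klScale klE0 n)) k))
    {t : ℝ} (ht : t ∈ Icc (0 : ℝ) 1) (Ng : ℕ) :
    IsGramBoundedR ((hubbardGridSub L M β Ng).transpose * softCovOf L M β μ K (Φ t) * hubbardGridSub L M β Ng) (Real.sqrt (klScale klE0 n * 15367)) :=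
  klmg_isGramBoundedR_gridSub_of_klSoftMass_le L M (pos_of_klBetaMin_le hβ) μ K Ng n (Φ t) (by norm_num)
    (klmg_klSoftMass_runningSymbol_le L M hK hβ hβL n i hi Φ hΦ ht)

end Summit.HubbardSuperconductivity.HubbardSuperconductivity.Theorems.KLRegimeSplit

end
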